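import Summits.BirchSwinnertonDyer.BirchSwinnertonDyer.Theorems.ByReductionTypeAtTwoFineSelmerConjAAtTwoAdditivePotGoodChevalleyDoorAtTwo
import Literature.NumberTheory.NumberFields.ClassGroupNormGalois
import HarnessLib

/-!
# The capitulation door: `v₂ h(L) = v₂ h(K)` for a quadratic extension with one ramified prime, from ONE ambiguous class

Sub-problem `BirchSwinnertonDyer`, route `ByReductionTypeAtTwo`, item `FineSelmerConjAAtTwoAdditivePotGood` (C1″), helper file
toward the 8 «Fukuda rows» of the census (displayed hypothesis `e₁ = e₀` along the cyclotomic `ℤ₂`-tower of the cubic point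
field `K`, whose prime above `2` is unique).

THE DOOR (`padicValNat_two_classNumber_eq_of_ambiguous`).  `L/K` Galois of degree `2`, unramified at infinity, at most ONE finite
prime of `K` ramified in `L`.  Suppose some class `c ∈ Cl(L)` is fixed by `Gal(L/K)` and `h_K ∣ m · ord(N_{L/K} c)` with `m` odd.
Then `v₂(h_L) = v₂(h_K)`.

PROOF.  Chevalley's formula (tree theorem `ambiguousClassNumberFormula`) reads `#Cl(L)^G · 2 · [E_K : E_K ∩ N L×] = h_K · 2^t`,
`t ≤ 1`, so `#Cl(L)^G ∣ h_K`; with `h_K ∣ m·ord(N c)`, `ord(N c) ∣ ord(c) ∣ #Cl(L)^G` all four numbers have the same `2`-adic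
valuation `a`.  Let `c₂ = c^{odd part}` (order `2^a`): every element of `Cl(L)^G` of `2`-power order lies in `⟨c₂⟩` (a bigger
`2`-subgroup would contradict `v₂ #Cl(L)^G = a`), and `N` is injective on `⟨c₂⟩` (`v₂ ord(N c₂) = a`).  The image
`D = (σ − 1)Cl(L)` has `#Cl(L) = #Cl(L)^G · #D`, `N ∘ (σ−1) = 1` and is `σ`-stable; if `2 ∣ #D`, the involution `σ` on the
elementary `2`-group `D[2] ≠ 1` has a fixed point `d ≠ 1` (parity), which lies in `Cl(L)^G ∩ ⟨c₂⟩ ∩ ker N = 1` — contradiction.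
Hence `2 ∤ #D` and `v₂ h_L = v₂ #Cl(L)^G = v₂ h_K`.  (Genus theory à la Chevalley–Gras; the case `c = 1`, `h_K` odd is the
classical «one ramified prime ⇒ parity is preserved».) [cite: Lang1990, Ch. 13 §4, Lemma 4.1] [cite: Gras2003, II.6.2]

## What this does NOT prove
The per-row certificates (a split prime `𝔮` of `K` generating `Cl(K)` and an ideal `𝔔 ∣ 𝔮` of `L` with ambiguous class) are not in
this file; nothing here touches Selmer groups.  BSD is not advanced by this file.
-/

set_option autoImplicit false
set_option linter.dupNamespace false

noncomputable section

open scoped Classical NumberField nonZeroDivisors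

namespace Summit.BirchSwinnertonDyer.BirchSwinnertonDyer.Theorems.AddKatoTwo

open NumberField IsDedekindDomain
open Literature.NumberTheory.NumberFields Literature.NumberTheory.NumberFields.AmbiguousClass
  Literature.NumberTheory.GaloisRepresentations
  Literature.NumberTheory.GaloisRepresentations.Herbrand Literature.NumberTheory.GaloisRepresentations.MinkowskiUnit
  Literature.NumberTheory.GaloisRepresentations.CyclicNormIndex

section Arithmetic

/-- `a ∣ b ≠ 0 ⟹ v_p(a) ≤ v_p(b)`. [folklore] -/
theorem padicValNat_le_of_dvd' {p a b : ℕ} [Fact p.Prime] (h : a ∣ b) (hb : b ≠ 0) :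
    padicValNat p a ≤ padicValNat p b := by
  obtain ⟨k, rfl⟩ := h
  have ha : a ≠ 0 := fun h0 => hb (by rw [h0, zero_mul])
  have hk : k ≠ 0 := fun h0 => hb (by rw [h0, mul_zero])
  rw [padicValNat.mul ha hk]; omega

/-- `2 ∤ m ⟹ v₂(m·x) = v₂(x)`. [folklore] -/
theorem padicValNat_odd_mul {m x : ℕ} (hm : Odd m) (hx : x ≠ 0) :
    padicValNat 2 (m * x) = padicValNat 2 x := by
  have hm0 : m ≠ 0 := by rintro rfl; exact absurd hm (by decide)
  rw [padicValNat.mul hm0 hx,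
    padicValNat.eq_zero_of_not_dvd (fun h2 => (Nat.not_even_iff_odd.mpr hm) (even_iff_two_dvd.mpr h2)), zero_add]

end Arithmetic

section Group

variable {C D' : Type} [CommGroup C] [Finite C] [CommGroup D'] [Finite D']

/-- **The algebraic heart.**  `C` a finite abelian group, `s` an automorphism with `s ∘ s = id`, `N : C → D'` a homomorphism with
`N ∘ s = N`, `Fix = ker (s/id)`.  If `c ∈ Fix` has `v₂(#Fix) ≤ v₂(ord (N c))`, then `v₂(#C) = v₂(#Fix)`. [folklore; cite: Gras2003, II.6.2] -/
theorem padicValNat_card_eq_card_fixed (s : C ≃* C) (hs : ∀ x, s (s x) = x) (N : C →* D') (hN : ∀ x, N (s x) = N x)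
    {c : C} (hc : s c = c) (hv : padicValNat 2 (Nat.card {x : C // s x = x}) ≤ padicValNat 2 (orderOf (N c))) :
    padicValNat 2 (Nat.card C) = padicValNat 2 (Nat.card {x : C // s x = x}) := by
  classical
  haveI : Fact (Nat.Prime 2) := ⟨Nat.prime_two⟩
  haveI : Fintype C := Fintype.ofFinite C
  -- the subgroup of fixed points and the map `φ = s/id`
  let Fix : Subgroup C :=
    { carrier := {x | s x = x}
      mul_mem' := fun {a b} ha hb => by simp only [Set.mem_setOf_eq] at ha hb ⊢; rw [map_mul, ha, hb]
      one_mem' := by simp only [Set.mem_setOf_eq, map_one]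
      inv_mem' := fun {a} ha => by simp only [Set.mem_setOf_eq] at ha ⊢; rw [map_inv, ha] }
  have hmemFix : ∀ x : C, x ∈ Fix ↔ s x = x := fun x => Iff.rfl
  have hFixcard : Nat.card Fix = Nat.card {x : C // s x = x} := rfl
  let φ : C →* C :=
    { toFun := fun a => s a * a⁻¹
      map_one' := by rw [map_one, inv_one, mul_one]
      map_mul' := fun a b => by rw [map_mul, mul_inv, mul_mul_mul_comm] }
  have hφ : ∀ a, φ a = s a * a⁻¹ := fun a => rfl
  have hker : φ.ker = Fix := by
    ext x; rw [MonoidHom.mem_ker, hφ, mul_inv_eq_one, hmemFix]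
  have hNφ : ∀ a, N (φ a) = 1 := fun a => by rw [hφ, map_mul, map_inv, hN, mul_inv_cancel]
  have hsφ : ∀ a, s (φ a) = φ (s a) := fun a => by rw [hφ, hφ, map_mul, map_inv, hs]
  -- `#C = #Fix · #D`
  set D := φ.range with hD
  have hcardC : Nat.card C = Nat.card Fix * Nat.card D := by
    rw [← hker, hD, ← Subgroup.index_ker, Subgroup.card_mul_index]
  have hFix0 : Nat.card Fix ≠ 0 := Nat.card_pos.ne'
  have hD0 : Nat.card D ≠ 0 := Nat.card_pos.ne'
  -- valuations: `a := v₂(#Fix) = v₂(ord c) = v₂(ord (N c))`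
  set a := padicValNat 2 (Nat.card Fix) with ha
  have hcFix : c ∈ Fix := hc
  have hordc_dvd : orderOf c ∣ Nat.card Fix := by
    have := orderOf_dvd_natCard (⟨c, hcFix⟩ : Fix)
    rwa [← Subgroup.orderOf_coe (⟨c, hcFix⟩ : Fix)] at this
  have hNc_dvd : orderOf (N c) ∣ orderOf c := orderOf_map_dvd N c
  have hordc0 : orderOf c ≠ 0 := (orderOf_pos c).ne'
  have hordNc0 : orderOf (N c) ≠ 0 := (orderOf_pos (N c)).ne'
  have hvc : padicValNat 2 (orderOf c) = a :=
    le_antisymm (padicValNat_le_of_dvd' hordc_dvd hFix0) (le_trans hv (padicValNat_le_of_dvd' hNc_dvd hordc0))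
  have hvNc : padicValNat 2 (orderOf (N c)) = a :=
    le_antisymm (le_trans (padicValNat_le_of_dvd' hNc_dvd hordc0) hvc.le) hv
  -- the odd part `o` of `ord c` and `c₂ = c^o` of order `2^a`
  obtain ⟨o, ho⟩ : 2 ^ a ∣ orderOf c := hvc ▸ pow_padicValNat_dvd
  have ho0 : o ≠ 0 := fun h0 => hordc0 (by rw [ho, h0, mul_zero])
  have hoodd : ¬ 2 ∣ o := by
    rintro ⟨o', rfl⟩
    have : 2 ^ (padicValNat 2 (orderOf c) + 1) ∣ orderOf c := ⟨o', by rw [hvc, ho]; ring⟩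
    exact pow_succ_padicValNat_not_dvd hordc0 this
  set c₂ := c ^ o with hc₂
  have hc₂Fix : c₂ ∈ Fix := Fix.pow_mem hcFix o
  have hordc₂ : orderOf c₂ = 2 ^ a := by
    rw [hc₂, orderOf_pow' c ho0, ho, Nat.gcd_mul_left_left, Nat.mul_div_cancel _ (Nat.pos_of_ne_zero ho0)]
  -- `N` is injective on `⟨c₂⟩`
  have hvNc₂ : padicValNat 2 (orderOf (N c₂)) = a := by
    rw [hc₂, map_pow, orderOf_pow' _ ho0, padicValNat.div_of_dvd (Nat.gcd_dvd_left _ _), hvNc,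
      padicValNat.eq_zero_of_not_dvd (fun h2 => hoodd (dvd_trans h2 (Nat.gcd_dvd_right _ _))), Nat.sub_zero]
  have hNinj : ∀ d ∈ Subgroup.zpowers c₂, N d = 1 → d = 1 := by
    intro d hd hNd
    obtain ⟨i, rfl⟩ := Subgroup.mem_zpowers_iff.mp hd
    rw [map_zpow] at hNd
    have h1 : (orderOf (N c₂) : ℤ) ∣ i := orderOf_dvd_iff_zpow_eq_one.mpr hNd
    have h2 : (2 ^ a : ℕ) ∣ orderOf (N c₂) := hvNc₂ ▸ pow_padicValNat_dvd
    have h3 : ((orderOf c₂ : ℕ) : ℤ) ∣ i := by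
      rw [hordc₂]; exact dvd_trans (Int.natCast_dvd_natCast.mpr h2) h1
    exact orderOf_dvd_iff_zpow_eq_one.mp h3
  -- every element of `Fix` of `2`-power order lies in `⟨c₂⟩`
  have htwo : ∀ x ∈ Fix, ∀ k : ℕ, x ^ 2 ^ k = 1 → x ∈ Subgroup.zpowers c₂ := by
    intro x hx k hxk
    set P := Subgroup.zpowers c₂ ⊔ Subgroup.zpowers x with hP
    have hPle : P ≤ Fix := sup_le ((Subgroup.zpowers_le).mpr hc₂Fix) ((Subgroup.zpowers_le).mpr hx)
    have hPgrp : IsPGroup 2 P := by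
      intro g
      obtain ⟨g, hg⟩ := g
      obtain ⟨y, hy, z, hz, hyz⟩ := Subgroup.mem_sup.mp hg
      obtain ⟨i, rfl⟩ := Subgroup.mem_zpowers_iff.mp hy
      obtain ⟨j, rfl⟩ := Subgroup.mem_zpowers_iff.mp hz
      refine ⟨a + k, Subtype.ext ?_⟩
      have hy1 : (c₂ ^ i) ^ 2 ^ (a + k) = 1 := by
        rw [← zpow_natCast, ← zpow_mul, mul_comm, zpow_mul, zpow_natCast, pow_add, pow_mul, ← hordc₂, pow_orderOf_eq_one,
          one_pow, one_zpow]
      have hz1 : (x ^ j) ^ 2 ^ (a + k) = 1 := by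
        rw [← zpow_natCast, ← zpow_mul, mul_comm, zpow_mul, zpow_natCast, pow_add, mul_comm, pow_mul, hxk, one_pow, one_zpow]
      rw [Subgroup.coe_pow, Subgroup.coe_one]
      change g ^ 2 ^ (a + k) = 1
      rw [← hyz, mul_pow, hy1, hz1, one_mul]
    obtain ⟨n, hn⟩ := IsPGroup.iff_card.mp hPgrp
    have h1 : 2 ^ n ∣ Nat.card Fix := by have h1 := Subgroup.card_dvd_of_le hPle; rwa [hn] at h1
    have hn_le : n ≤ a := (padicValNat_dvd_iff_le hFix0).mp h1
    have h2 : Nat.card (Subgroup.zpowers c₂) ∣ Nat.card P := Subgroup.card_dvd_of_le le_sup_left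
    rw [Nat.card_zpowers, hordc₂, hn, Nat.pow_dvd_pow_iff_le_right (by norm_num)] at h2
    have hPeq : Subgroup.zpowers c₂ = P := by
      apply Subgroup.eq_of_le_of_card_ge le_sup_left
      rw [hn, Nat.card_zpowers, hordc₂]
      exact Nat.pow_le_pow_right (by norm_num) hn_le
    rw [hPeq]; exact Subgroup.mem_sup_right (Subgroup.mem_zpowers x)
  -- `2 ∤ #D`
  have hDodd : ¬ 2 ∣ Nat.card D := by
    intro h2D
    haveI : Fintype D := Fintype.ofFinite D
    obtain ⟨x, hx⟩ := exists_prime_orderOf_dvd_card (G := D) 2 (by rwa [← Nat.card_eq_fintype_card])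
    -- the elementary `2`-torsion of `D`
    let T : Subgroup C :=
      { carrier := {d | d ∈ D ∧ d ^ 2 = 1}
        mul_mem' := fun {u v} hu hv => ⟨D.mul_mem hu.1 hv.1, by rw [mul_pow, hu.2, hv.2, one_mul]⟩
        one_mem' := ⟨D.one_mem, one_pow 2⟩
        inv_mem' := fun {u} hu => ⟨D.inv_mem hu.1, by rw [inv_pow, hu.2, inv_one]⟩ }
    have hmemT : ∀ d : C, d ∈ T ↔ d ∈ D ∧ d ^ 2 = 1 := fun d => Iff.rfl
    have hxT : (x : C) ∈ T := by
      refine ⟨x.2, ?_⟩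
      have := pow_orderOf_eq_one x
      rw [hx] at this
      exact_mod_cast congrArg Subtype.val this
    -- `#T` is even
    have hTeven : 2 ∣ Nat.card T := by
      have h1 : orderOf (⟨(x : C), hxT⟩ : T) = 2 := by
        rw [← Subgroup.orderOf_coe (⟨(x : C), hxT⟩ : T)]
        change orderOf ((x : D) : C) = 2
        rw [Subgroup.orderOf_coe, hx]
      exact h1 ▸ orderOf_dvd_natCard _
    -- `s` acts on `T` as an involution
    have hsD : ∀ d ∈ D, s d ∈ D := by
      rintro d ⟨a, rfl⟩; exact ⟨s a, (hsφ a).symm⟩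
    have hsT : ∀ d ∈ T, s d ∈ T := fun d hd => ⟨hsD d hd.1, by rw [← map_pow, hd.2, map_one]⟩
    haveI : Fintype T := Fintype.ofFinite T
    let f : Function.End T := fun d => ⟨s d, hsT d d.2⟩
    have hf : f ^ 2 ^ 1 = 1 := by
      funext d; apply Subtype.ext
      show (s (s d)) = d
      exact hs d
    have hmod := Equiv.Perm.card_fixedPoints_modEq (p := 2) (n := 1) hf
    have hfixeven : 2 ∣ Fintype.card (Function.fixedPoints f) := by
      have : 2 ∣ Fintype.card T := by rwa [← Nat.card_eq_fintype_card]
      exact (Nat.ModEq.dvd_iff hmod (dvd_refl 2)).mp this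
    -- a fixed point `d ≠ 1`
    have hone : (⟨1, T.one_mem⟩ : T) ∈ Function.fixedPoints f := by
      rw [Function.mem_fixedPoints, Function.IsFixedPt]; apply Subtype.ext; show s 1 = 1; exact map_one s
    have hlt : 1 < Fintype.card (Function.fixedPoints f) := by
      have hpos : 0 < Fintype.card (Function.fixedPoints f) := Fintype.card_pos_iff.mpr ⟨⟨_, hone⟩⟩
      obtain ⟨k, hk⟩ := hfixeven
      omega
    obtain ⟨u, v, huv⟩ := Fintype.exists_pair_of_one_lt_card hlt
    have hex : ∃ w : Function.fixedPoints f, (w : T) ≠ ⟨1, T.one_mem⟩ := by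
      by_cases hu : (u : T) = ⟨1, T.one_mem⟩
      · refine ⟨v, fun hv => huv (Subtype.ext (hu.trans hv.symm))⟩
      · exact ⟨u, hu⟩
    obtain ⟨w, hw⟩ := hex
    have hwfix : s ((w : T) : C) = ((w : T) : C) := by
      have := w.2
      rw [Function.mem_fixedPoints, Function.IsFixedPt] at this
      exact congrArg (fun t : T => (t : C)) this
    have hwT : ((w : T) : C) ∈ T := (w : T).2
    have hw1 : ((w : T) : C) ≠ 1 := fun h => hw (Subtype.ext h)
    -- `w ∈ Fix`, of `2`-power order, hence in `⟨c₂⟩`; `N w = 1`; so `w = 1`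
    have hwz : ((w : T) : C) ∈ Subgroup.zpowers c₂ := htwo _ hwfix 1 (by rw [pow_one]; exact hwT.2)
    have hNw : N ((w : T) : C) = 1 := by
      obtain ⟨a', ha'⟩ := hwT.1
      rw [← ha']; exact hNφ a'
    exact hw1 (hNinj _ hwz hNw)
  -- conclusion
  rw [hcardC, padicValNat.mul hFix0 hD0, padicValNat.eq_zero_of_not_dvd hDodd, add_zero]
  exact congrArg (padicValNat 2) hFixcard

end Group

/-! ## The door for `L/K` quadratic with at most one ramified prime -/

section Door

variable {K L : Type} [Field K] [NumberField K] [Field L] [NumberField L] [Algebra K L]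

/-- **The capitulation door.** `L/K` Galois of degree `2`, unramified at the infinite places, at most one prime of `K` ramified in
`L`; if a class `c ∈ Cl(L)` is fixed by `Gal(L/K)` and `h_K ∣ m · ord(N_{L/K} c)` with `m` odd, then `v₂(h_L) = v₂(h_K)`.
(Chevalley's formula gives `#Cl(L)^G ∣ h_K`; the rest is `padicValNat_card_eq_card_fixed`.)
[cite: Lang1990, Ch. 13 §4, Lemma 4.1 (PDF p. 203)] [cite: Gras2003, II.6.2.3] -/
theorem padicValNat_two_classNumber_eq_of_ambiguous [IsGalois K L] [IsUnramifiedAtInfinitePlaces K L]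
    (hdeg : Module.finrank K L = 2)
    (ht : {v : HeightOneSpectrum (𝓞 K) | v.asIdeal.ramificationIdxIn (𝓞 L) ≠ 1}.ncard ≤ 1)
    {c : ClassGroup (𝓞 L)} (hc : ∀ τ : L ≃ₐ[K] L, ClassGroup.mulEquiv (intAut τ) c = c)
    {m : ℕ} (hm : Odd m) (hN : classNumber K ∣ m * orderOf (classGroupNorm K L c)) :
    padicValNat 2 (classNumber L) = padicValNat 2 (classNumber K) := by
  classical
  haveI : FiniteDimensional K L := Module.Finite.of_restrictScalars_finite ℚ K L
  have hcard : Nat.card (L ≃ₐ[K] L) = 2 := by rw [IsGalois.card_aut_eq_finrank, hdeg]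
  haveI : Fact (Nat.Prime 2) := ⟨Nat.prime_two⟩
  haveI : IsCyclic (L ≃ₐ[K] L) := isCyclic_of_prime_card hcard
  obtain ⟨σ, hσ⟩ := IsCyclic.exists_generator (α := L ≃ₐ[K] L)
  have h := ambiguousClassNumberFormula hσ
  rw [archFactor_eq_one, mul_one, finprod_ramificationIdxIn_eq_pow_of_prime Nat.prime_two hdeg, hdeg] at h
  set t := {v : HeightOneSpectrum (𝓞 K) | v.asIdeal.ramificationIdxIn (𝓞 L) ≠ 1}.ncard with htdef
  set F := Nat.card {c : ClassGroup (𝓞 L) // ∀ τ : L ≃ₐ[K] L, ClassGroup.mulEquiv (intAut τ) c = c} with hF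
  set idx := (unitsE L ⊓ (⊤ : Subgroup Lˣ).map (Herbrand.norm (L ≃ₐ[K] L))).relIndex (unitsE L ⊓ (unitsIncl K L).range)
    with hidx
  -- `F ∣ h_K`
  have hFdvd : F ∣ classNumber K := by
    interval_cases t
    · exact ⟨2 * idx, by rw [pow_zero, mul_one] at h; linarith⟩
    · exact ⟨idx, by rw [pow_one] at h; linarith⟩
  -- `σ ≠ 1`, every `τ` is `1` or `σ`, and `σ² = 1`
  have hσ1 : σ ≠ 1 := by
    intro h1
    have : Nat.card (L ≃ₐ[K] L) = 1 := by
      rw [← Subgroup.card_top (G := L ≃ₐ[K] L), ← (Subgroup.eq_top_iff' (Subgroup.zpowers σ)).mpr hσ, h1,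
        Subgroup.zpowers_one_eq_bot, Subgroup.card_bot]
    omega
  have hτ : ∀ τ : L ≃ₐ[K] L, τ = 1 ∨ τ = σ := by
    intro τ
    by_cases h1 : τ = 1
    · exact Or.inl h1
    · right
      obtain ⟨y, -, hy⟩ := (Nat.card_eq_two_iff' (1 : L ≃ₐ[K] L)).mp hcard
      rw [hy τ h1, hy σ hσ1]
  have hσσ : σ * σ = 1 := by
    have h1 : σ ^ Nat.card (L ≃ₐ[K] L) = 1 := pow_card_eq_one'
    rwa [hcard, pow_two] at h1
  set s : ClassGroup (𝓞 L) ≃* ClassGroup (𝓞 L) := ClassGroup.mulEquiv (intAut σ) with hsdef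
  have hs : ∀ x, s (s x) = x := by
    intro x
    have h2 := congrArg (fun e => e x) (mulEquiv_intAut_mul (F := K) σ σ)
    simp only [MulEquiv.trans_apply] at h2
    rw [hσσ, mulEquiv_intAut_one, MulEquiv.refl_apply] at h2
    exact h2.symm
  -- fixed by all `τ` ⟺ fixed by `σ`
  have hfix_iff : ∀ x : ClassGroup (𝓞 L), (∀ τ : L ≃ₐ[K] L, ClassGroup.mulEquiv (intAut τ) x = x) ↔ s x = x := by
    intro x
    refine ⟨fun hx => hx σ, fun hx τ => ?_⟩
    rcases hτ τ with rfl | rfl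
    · rw [mulEquiv_intAut_one, MulEquiv.refl_apply]
    · exact hx
  have hFeq : F = Nat.card {x : ClassGroup (𝓞 L) // s x = x} :=
    Nat.card_congr (Equiv.subtypeEquivRight hfix_iff)
  haveI : Nonempty {x : ClassGroup (𝓞 L) // s x = x} := ⟨⟨1, map_one s⟩⟩
  -- the algebraic heart
  set N := classGroupNorm K L with hNdef
  have hNs : ∀ x, N (s x) = N x := fun x => classGroupNorm_galois_smul K L σ x
  have hK0 : classNumber K ≠ 0 := by rw [NumberField.classNumber]; exact Fintype.card_ne_zero
  have hordN0 : orderOf (N c) ≠ 0 := (orderOf_pos (N c)).ne'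
  have hv : padicValNat 2 (Nat.card {x : ClassGroup (𝓞 L) // s x = x}) ≤ padicValNat 2 (orderOf (N c)) := by
    rw [← hFeq]
    calc padicValNat 2 F ≤ padicValNat 2 (classNumber K) := padicValNat_le_of_dvd' hFdvd hK0
      _ ≤ padicValNat 2 (m * orderOf (N c)) := padicValNat_le_of_dvd' hN (mul_ne_zero (by rintro rfl; exact absurd hm (by decide)) hordN0)
      _ = padicValNat 2 (orderOf (N c)) := padicValNat_odd_mul hm hordN0
  have heart := padicValNat_card_eq_card_fixed s hs N hNs ((hfix_iff c).mp hc) hv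
  -- `v₂ F = v₂ h_K`
  have hvF : padicValNat 2 F = padicValNat 2 (classNumber K) := by
    apply le_antisymm (padicValNat_le_of_dvd' hFdvd hK0)
    calc padicValNat 2 (classNumber K) ≤ padicValNat 2 (m * orderOf (N c)) :=
          padicValNat_le_of_dvd' hN (mul_ne_zero (by rintro rfl; exact absurd hm (by decide)) hordN0)
      _ = padicValNat 2 (orderOf (N c)) := padicValNat_odd_mul hm hordN0
      _ ≤ padicValNat 2 (orderOf c) := padicValNat_le_of_dvd' (orderOf_map_dvd N c) (orderOf_pos c).ne'
      _ ≤ padicValNat 2 F := by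
          rw [hFeq]
          refine padicValNat_le_of_dvd' ?_ (Nat.card_pos (α := {x : ClassGroup (𝓞 L) // s x = x})).ne'
          have hcs : s c = c := (hfix_iff c).mp hc
          -- `ord c ∣ #Fix` via the subgroup of fixed points
          let Fix : Subgroup (ClassGroup (𝓞 L)) :=
            { carrier := {x | s x = x}
              mul_mem' := fun {a b} ha hb => by simp only [Set.mem_setOf_eq] at ha hb ⊢; rw [map_mul, ha, hb]
              one_mem' := by simp only [Set.mem_setOf_eq, map_one]
              inv_mem' := fun {a} ha => by simp only [Set.mem_setOf_eq] at ha ⊢; rw [map_inv, ha] }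
          have := orderOf_dvd_natCard (⟨c, hcs⟩ : Fix)
          rwa [← Subgroup.orderOf_coe (⟨c, hcs⟩ : Fix)] at this
  rw [NumberField.classNumber, ← Nat.card_eq_fintype_card, heart, ← hFeq, hvF]

end Door

end Summit.BirchSwinnertonDyer.BirchSwinnertonDyer.Theorems.AddKatoTwo

end
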